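import Literature.Analysis.FluidPDE.PlanarShearedGraphBand
import Literature.Analysis.FluidPDE.PlanarCornerElement
import HarnessLib

/-!
# The sheared corner element: the diagonal graph band with material abscissa `u + λ (v - T(u))`

Topic `Literature/Analysis/FluidPDE`. The corner element of `PlanarCornerElement.lean` (the graph
band of the diagonal frame `A`, `PlanarDiagonalFrame.lean`) built on the SHEARED graph band of
`PlanarShearedGraphBand.lean` (static graph `T`, constant shear `λ`):

* `shCornerScalar Gp lam T Ξ Ξx t z = Gp ((Ψ_λ(t, A z))₁)`,
* `shCornerVelocity lam g gx T Tx t z = A⁻¹ V_λ(t, A z)`,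
* `shCornerStream lam g T t z = ½ H_λ(t, A z)`.

Proved exactly as for the corner element, from the sheared band: transport
(`transport_shCornerScalar`), incompressibility (`divergence_shCornerVelocity`), the
stream-function identity (`shCornerVelocity_eq_perpGrad_shCornerStream`), smoothness, the static
case, and the reduction to the corner element at `λ = 0`. With `λ = 1/2` (resp. `-1/2`) the width
transitions carried by the arm of frame slope `+1` (resp. `-1`) are unsheared
(`shAbscissa_normal_invariant`), which is what the re-description certificates between run-hosted
and corner-hosted width kinks use (`PlanarRedescription.lean`).

Folklore; no named facts. Infrastructure towards a discharge of `acm_compatible_blocks`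
(`QuasiSelfSimilarCompatibleBlocks.lean`).

## References

* G. Alberti, G. Crippa, A. L. Mazzucato, *Exponential self-similar mixing by incompressible
  flows*, J. Amer. Math. Soc. 32 (2019), 445–490, §7 (arXiv:1605.02090).
-/

noncomputable section

open Function Set Filter
open scoped Topology ContDiff

namespace Literature.Analysis.FluidPDE

namespace PlanarKinematics

/-- The plane `ℝ²` as a Euclidean space. [folklore] -/
local notation "E²" => EuclideanSpace ℝ (Fin 2)

variable {G : Type*} [NormedAddCommGroup G] [NormedSpace ℝ G]

/-! ## Definitions -/

/-- **Sheared corner element, scalar**: `Θ(t, z) = Gp ((Ψ_λ(t, A z))₁)`. [folklore] -/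
def shCornerScalar (Gp : ℝ → G) (lam : ℝ) (T : ℝ → ℝ) (Ξ Ξx : ℝ → ℝ → ℝ) (t : ℝ) (z : E²) : G :=
  Gp ((shGraphPullback lam T Ξ Ξx t (diagFrame z)) 1)

/-- **Sheared corner element, velocity**: `V(t, z) = A⁻¹ V_λ(t, A z)`. [folklore] -/
def shCornerVelocity (lam : ℝ) (g gx : ℝ → ℝ → ℝ) (T Tx : ℝ → ℝ) (t : ℝ) (z : E²) : E² :=
  diagFrameInv (shGraphVelocity lam g gx T Tx t (diagFrame z))

/-- **Sheared corner element, stream function**: `H(t, z) = ½ H_λ(t, A z)`. [folklore] -/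
def shCornerStream (lam : ℝ) (g : ℝ → ℝ → ℝ) (T : ℝ → ℝ) (t : ℝ) (z : E²) : ℝ :=
  2⁻¹ * shGraphStream lam g T t (diagFrame z)

omit [NormedAddCommGroup G] [NormedSpace ℝ G] in
/-- Unfolding the sheared corner scalar. [folklore] -/
theorem shCornerScalar_apply (Gp : ℝ → G) (lam : ℝ) (T : ℝ → ℝ) (Ξ Ξx : ℝ → ℝ → ℝ) (t : ℝ) (z : E²) :
    shCornerScalar Gp lam T Ξ Ξx t z =
      Gp (((z 0 + z 1) - T (z 0 - z 1)) /
        Ξx t ((z 0 - z 1) + lam * ((z 0 + z 1) - T (z 0 - z 1)))) := by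
  simp only [shCornerScalar, shGraphPullback_apply, shAbscissa_apply, diagFrame_apply, vec2_apply_zero,
    vec2_apply_one]

/-- Unfolding the sheared corner velocity. [folklore] -/
theorem shCornerVelocity_apply (lam : ℝ) (g gx : ℝ → ℝ → ℝ) (T Tx : ℝ → ℝ) (t : ℝ) (z : E²) :
    shCornerVelocity lam g gx T Tx t z = diagFrameInv (shGraphVelocity lam g gx T Tx t (diagFrame z)) := rfl

/-- Unfolding the sheared corner stream function. [folklore] -/
theorem shCornerStream_apply (lam : ℝ) (g : ℝ → ℝ → ℝ) (T : ℝ → ℝ) (t : ℝ) (z : E²) :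
    shCornerStream lam g T t z = 2⁻¹ * shGraphStream lam g T t (diagFrame z) := rfl

omit [NormedAddCommGroup G] [NormedSpace ℝ G] in
/-- **No shear gives the corner element** (scalar, static profile). [folklore] -/
theorem shCornerScalar_zero (Gp : ℝ → G) (T : ℝ → ℝ) (Ξ Ξx : ℝ → ℝ → ℝ) :
    shCornerScalar Gp 0 T Ξ Ξx = cornerScalar Gp (fun _ => T) Ξ Ξx := by
  funext t z
  simp only [shCornerScalar, cornerScalar, shGraphPullback_zero]

/-- **No shear gives the corner element** (velocity, static profile). [folklore] -/
theorem shCornerVelocity_zero (g gx : ℝ → ℝ → ℝ) (T Tx : ℝ → ℝ) :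
    shCornerVelocity 0 g gx T Tx = cornerVelocity g gx (fun _ => T) (fun _ _ => 0) (fun _ => Tx) := by
  funext t z
  simp only [shCornerVelocity, cornerVelocity, shGraphVelocity_zero]

/-- **No shear gives the corner element** (stream function, static profile). [folklore] -/
theorem shCornerStream_zero (g : ℝ → ℝ → ℝ) (T : ℝ → ℝ) :
    shCornerStream 0 g T = cornerStream g (fun _ => T) (fun _ _ => 0) := by
  funext t z
  simp only [shCornerStream, cornerStream, shGraphStream_zero]

/-! ## Transport, incompressibility, stream function -/

/-- **The sheared corner element is transported**: with the hypotheses of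
`shGraph_pullback_identity` at the frame point `(t, A z)` and a profile `Gp` differentiable at the
transverse reference coordinate, `∂ₜΘ + D_zΘ[V] = 0` at `(t, z)`. [folklore] -/
theorem transport_shCornerScalar {Gp : ℝ → G} {lam : ℝ} {T Tx : ℝ → ℝ} {Ξ Ξx Ξt Ξxx Ξxt : ℝ → ℝ → ℝ}
    {t : ℝ} {z : E²} (hG : DifferentiableAt ℝ Gp ((shGraphPullback lam T Ξ Ξx t (diagFrame z)) 1))
    (hTx : HasDerivAt T (Tx ((diagFrame z) 0)) ((diagFrame z) 0))
    (ht : HasDerivAt (fun s => Ξ s (shAbscissa lam T (diagFrame z)))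
      (Ξt t (shAbscissa lam T (diagFrame z))) t)
    (hx : HasDerivAt (Ξ t) (Ξx t (shAbscissa lam T (diagFrame z))) (shAbscissa lam T (diagFrame z)))
    (hxx : HasDerivAt (Ξx t) (Ξxx t (shAbscissa lam T (diagFrame z))) (shAbscissa lam T (diagFrame z)))
    (hxt : HasDerivAt (fun s => Ξx s (shAbscissa lam T (diagFrame z)))
      (Ξxt t (shAbscissa lam T (diagFrame z))) t)
    (hne : Ξx t (shAbscissa lam T (diagFrame z)) ≠ 0) :
    deriv (fun s => shCornerScalar Gp lam T Ξ Ξx s z) t +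
      fderiv ℝ (shCornerScalar Gp lam T Ξ Ξx t) z
        (shCornerVelocity lam (axialRate Ξx Ξt) (axialRateDeriv Ξx Ξt Ξxx Ξxt) T Tx t z) = 0 := by
  set Θf : ℝ → E² → G := fun s w => Gp ((shGraphPullback lam T Ξ Ξx s w) 1) with hΘf
  have hf1 : DifferentiableAt ℝ (fun w : E² => w 1) (shGraphPullback lam T Ξ Ξx t (diagFrame z)) :=
    (EuclideanSpace.proj (1 : Fin 2) : E² →L[ℝ] ℝ).differentiableAt
  have hproj : DifferentiableAt ℝ (fun w : E² => Gp (w 1)) (shGraphPullback lam T Ξ Ξx t (diagFrame z)) :=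
    hG.comp (shGraphPullback lam T Ξ Ξx t (diagFrame z)) hf1
  have hframe := transport_comp_shGraphPullback (Θ := fun w : E² => Gp (w 1)) hproj hTx ht hx hxx hxt hne
  have hslice : DifferentiableAt ℝ (Θf t) (diagFrame z) :=
    hproj.comp _ (hasFDerivAt_shGraphPullback hTx hx hxx hne).differentiableAt
  exact transport_conj_diagFrame (Θ := Θf)
    (V := shGraphVelocity lam (axialRate Ξx Ξt) (axialRateDeriv Ξx Ξt Ξxx Ξxt) T Tx) hslice hframe

/-- **The sheared corner velocity is divergence free** (frame invariance of the divergence and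
`divergence_shGraphVelocity`). [folklore] -/
theorem divergence_shCornerVelocity {lam : ℝ} {g gx : ℝ → ℝ → ℝ} {T Tx : ℝ → ℝ} {t : ℝ} {z : E²}
    (hg : HasDerivAt (g t) (gx t (shAbscissa lam T (diagFrame z))) (shAbscissa lam T (diagFrame z)))
    (hgx : DifferentiableAt ℝ (gx t) (shAbscissa lam T (diagFrame z)))
    (hT : HasDerivAt T (Tx ((diagFrame z) 0)) ((diagFrame z) 0)) (hTx : DifferentiableAt ℝ Tx ((diagFrame z) 0)) :
    ∑ j, fderiv ℝ (shCornerVelocity lam g gx T Tx t) z (EuclideanSpace.single j 1) j = 0 := by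
  have hV : DifferentiableAt ℝ (shGraphVelocity lam g gx T Tx t) (diagFrame z) := by
    have hp0 : DifferentiableAt ℝ (fun w : E² => w 0) (diagFrame z) :=
      (EuclideanSpace.proj (0 : Fin 2) : E² →L[ℝ] ℝ).differentiableAt
    have h1 : DifferentiableAt ℝ (fun w : E² => w 1) (diagFrame z) :=
      (EuclideanSpace.proj (1 : Fin 2) : E² →L[ℝ] ℝ).differentiableAt
    have hT0 : DifferentiableAt ℝ (fun w : E² => T (w 0)) (diagFrame z) :=
      hT.differentiableAt.comp (diagFrame z) hp0
    have hTx0 : DifferentiableAt ℝ (fun w : E² => Tx (w 0)) (diagFrame z) := hTx.comp (diagFrame z) hp0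
    have hs : DifferentiableAt ℝ (fun w : E² => w 1 - T (w 0)) (diagFrame z) := h1.sub hT0
    have hξ : DifferentiableAt ℝ (shAbscissa lam T) (diagFrame z) :=
      (hasFDerivAt_shAbscissa hT).differentiableAt
    have hgξ : DifferentiableAt ℝ (fun w : E² => g t (shAbscissa lam T w)) (diagFrame z) :=
      hg.differentiableAt.comp (diagFrame z) hξ
    have hgxξ : DifferentiableAt ℝ (fun w : E² => gx t (shAbscissa lam T w)) (diagFrame z) :=
      hgx.comp (diagFrame z) hξ
    have e : shGraphVelocity lam g gx T Tx t = fun w : E² => vec2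
        (g t (shAbscissa lam T w) + lam * (w 1 - T (w 0)) * gx t (shAbscissa lam T w))
        (Tx (w 0) * g t (shAbscissa lam T w) -
          (1 - lam * Tx (w 0)) * (w 1 - T (w 0)) * gx t (shAbscissa lam T w)) := rfl
    rw [e]
    exact ((hgξ.add (((differentiableAt_const _).mul hs).mul hgxξ)).smul_const _).add
      (((hTx0.mul hgξ).sub ((((differentiableAt_const _).sub ((differentiableAt_const _).mul hTx0)).mul
        hs).mul hgxξ)).smul_const _)
  exact divergence_conj_diagFrame_eq_zero hV (divergence_shGraphVelocity hg hgx hT hTx)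

/-- **The sheared corner velocity is the perpendicular gradient of its stream function.**
[folklore] -/
theorem shCornerVelocity_eq_perpGrad_shCornerStream {lam : ℝ} {g gx : ℝ → ℝ → ℝ} {T Tx : ℝ → ℝ}
    {t : ℝ} {z : E²}
    (hg : HasDerivAt (g t) (gx t (shAbscissa lam T (diagFrame z))) (shAbscissa lam T (diagFrame z)))
    (hT : HasDerivAt T (Tx ((diagFrame z) 0)) ((diagFrame z) 0)) :
    shCornerVelocity lam g gx T Tx t z = perpGrad (shCornerStream lam g T t) z := by
  have hframe := shGraphVelocity_eq_perp_fderiv_shGraphStream (t := t) (z := diagFrame z) hg hT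
  have hH : DifferentiableAt ℝ (shGraphStream lam g T t) (diagFrame z) :=
    (hasFDerivAt_shGraphStream hg hT).differentiableAt
  rw [shCornerVelocity_apply, hframe, diagFrameInv_perp_fderiv hH]
  have hd : DifferentiableAt ℝ (fun w => shGraphStream lam g T t (diagFrame w)) z :=
    differentiableAt_comp_diagFrame hH
  have e : shCornerStream lam g T t = fun w => 2⁻¹ * shGraphStream lam g T t (diagFrame w) := rfl
  refine vec2_eq_perpGrad ?_ ?_
  · rw [e, fderiv_const_mul hd]; rfl
  · rw [e, fderiv_const_mul hd]; rfl

/-! ## Smoothness and the static case -/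

/-- **The sheared corner scalar is smooth** when the profile and the data are. [folklore] -/
theorem contDiff_uncurry_shCornerScalar {Gp : ℝ → G} {lam : ℝ} {T : ℝ → ℝ} {Ξ Ξx : ℝ → ℝ → ℝ}
    (hGp : ContDiff ℝ ∞ Gp) (hT : ContDiff ℝ ∞ T) (hΞ : ContDiff ℝ ∞ (uncurry Ξ))
    (hΞx : ContDiff ℝ ∞ (uncurry Ξx)) (hne : ∀ t x, Ξx t x ≠ 0) :
    ContDiff ℝ ∞ (uncurry (shCornerScalar Gp lam T Ξ Ξx)) := by
  have h1 : ContDiff ℝ ∞ (uncurry fun t w => (fun q : E² => Gp (q 1)) (shGraphPullback lam T Ξ Ξx t w)) :=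
    contDiff_uncurry_comp_shGraphPullback (hGp.comp (contDiff_coord 1)) hT hΞ hΞx hne
  exact contDiff_uncurry_comp_diagFrame h1

/-- **The sheared corner velocity is smooth** when its data are. [folklore] -/
theorem contDiff_uncurry_shCornerVelocity {lam : ℝ} {g gx : ℝ → ℝ → ℝ} {T Tx : ℝ → ℝ}
    (hg : ContDiff ℝ ∞ (uncurry g)) (hgx : ContDiff ℝ ∞ (uncurry gx)) (hT : ContDiff ℝ ∞ T)
    (hTx : ContDiff ℝ ∞ Tx) : ContDiff ℝ ∞ (uncurry (shCornerVelocity lam g gx T Tx)) :=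
  contDiff_uncurry_conj_diagFrame (contDiff_uncurry_shGraphVelocity hg hgx hT hTx)

/-- **The sheared corner stream function is smooth** when `g, T` are. [folklore] -/
theorem contDiff_uncurry_shCornerStream {lam : ℝ} {g : ℝ → ℝ → ℝ} {T : ℝ → ℝ}
    (hg : ContDiff ℝ ∞ (uncurry g)) (hT : ContDiff ℝ ∞ T) :
    ContDiff ℝ ∞ (uncurry (shCornerStream lam g T)) :=
  contDiff_const.mul (contDiff_uncurry_comp_diagFrame (contDiff_uncurry_shGraphStream hg hT))

/-- **A static sheared corner does not move**: with vanishing rate data the velocity vanishes.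
[folklore] -/
theorem shCornerVelocity_eq_zero_of_static {lam : ℝ} {g gx : ℝ → ℝ → ℝ} {T Tx : ℝ → ℝ} {t : ℝ} {z : E²}
    (hg : g t (shAbscissa lam T (diagFrame z)) = 0) (hgx : gx t (shAbscissa lam T (diagFrame z)) = 0) :
    shCornerVelocity lam g gx T Tx t z = 0 := by
  rw [shCornerVelocity_apply, shGraphVelocity_eq_zero hg hgx, diagFrameInv_apply]
  simp [vec2_eq_zero_iff]

end PlanarKinematics

end Literature.Analysis.FluidPDE
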